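import Literature.Analysis.Complex.DbarAlongCalculus
import Mathlib.LinearAlgebra.StdBasis
import HarnessLib

/-!
# `∂̄_v u = 0` for all `v` iff `u` is holomorphic (the Cauchy–Riemann equations)

For a function `u : E → F` between complex normed spaces which is real-differentiable at `x`,
the directional Cauchy–Riemann operators `∂̄_v u (x) = ½ (Du(x)[v] + i Du(x)[iv])`
(`Literature.Analysis.Complex.dbarAlong`, `Literature/Analysis/Complex/CauchyPompeiu.lean`) all
vanish iff `Du(x)` is `ℂ`-linear, i.e. iff `u` is complex-differentiable at `x`
(`differentiableAt_complex_iff_dbarAlong_eq_zero`; Hörmander (1973), §1.1 and §2.1: "`u` is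
analytic iff `∂u/∂z̄_j = 0` for all `j`"). We also record the dependence of `∂̄_v` on the
direction: additive in `v` and conjugate-homogeneous, `∂̄_{c v} = c̄ ∂̄_v` (`dbarAlong_add_left`,
`dbarAlong_smul_left`; so `v ↦ ∂̄_v u (x)` is a conjugate-linear map, `dbarAlongₛₗ`), hence
vanishing on a spanning set suffices (`dbarAlong_eq_zero_of_span_eq_top`), in particular on the
coordinate vectors `e_j` of `ℂ^ι` (`differentiableAt_complex_of_forall_single`: the Cauchy–Riemann
equations `∂u/∂z̄_j = 0`, Hörmander Def. 2.1.1).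

## References

* L. Hörmander, *An Introduction to Complex Analysis in Several Variables*, 2nd ed. (1973),
  §1.1 (analyticity as `∂u/∂z̄ = 0`) and §2.1, Def. 2.1.1 (the Cauchy–Riemann equations
  `∂u/∂z̄_j = 0`). [HormanderSCV1973]
-/

noncomputable section

open Set Filter Function Complex
open scoped Topology ComplexConjugate

namespace Literature.Analysis.Complex

variable {E : Type*} [NormedAddCommGroup E] [NormedSpace ℂ E]
  {F : Type*} [NormedAddCommGroup F] [NormedSpace ℂ F]

/-! ### Dependence on the direction -/

/-- `∂̄_{v+w} = ∂̄_v + ∂̄_w`. [folklore] -/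
theorem dbarAlong_add_left (v w : E) (u : E → F) (x : E) :
    dbarAlong (v + w) u x = dbarAlong v u x + dbarAlong w u x := by
  simp only [dbarAlong_apply, smul_add, map_add]
  module

/-- `∂̄_{i v} = -i ∂̄_v`. [folklore] -/
theorem dbarAlong_I_smul_left (v : E) (u : E → F) (x : E) :
    dbarAlong (I • v) u x = -I • dbarAlong v u x := by
  rw [dbarAlong_apply, dbarAlong_apply, smul_smul I I v, I_mul_I, neg_one_smul, map_neg, smul_neg]
  match_scalars <;> first | ring1 | linear_combination (2 : ℂ)⁻¹ * I_mul_I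

/-- Real homogeneity: `∂̄_{a v} = a ∂̄_v` for `a ∈ ℝ`. [folklore] -/
theorem dbarAlong_real_smul_left (a : ℝ) (v : E) (u : E → F) (x : E) :
    dbarAlong (a • v) u x = a • dbarAlong v u x := by
  rw [dbarAlong_apply, dbarAlong_apply, smul_comm I a v, map_smul, map_smul]
  simp only [← coe_smul]
  module

/-- **Conjugate homogeneity**: `∂̄_{c v} = c̄ ∂̄_v` for `c ∈ ℂ` (`∂/∂z̄` is conjugate-linear in
the direction). [folklore] -/
theorem dbarAlong_smul_left (c : ℂ) (v : E) (u : E → F) (x : E) :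
    dbarAlong (c • v) u x = conj c • dbarAlong v u x := by
  have hc : c • v = (c.re : ℝ) • v + (c.im : ℝ) • (I • v) := by
    rw [← coe_smul, ← coe_smul, smul_smul, ← add_smul, re_add_im]
  rw [hc, dbarAlong_add_left, dbarAlong_real_smul_left, dbarAlong_real_smul_left,
    dbarAlong_I_smul_left, ← coe_smul, ← coe_smul, smul_smul, ← add_smul]
  congr 1
  apply Complex.ext <;> simp

variable (F) in
/-- The conjugate-linear map `v ↦ ∂̄_v u (x)`. [folklore] -/
def dbarAlongₛₗ (u : E → F) (x : E) : E →ₗ⋆[ℂ] F where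
  toFun v := dbarAlong v u x
  map_add' v w := dbarAlong_add_left v w u x
  map_smul' c v := dbarAlong_smul_left c v u x

/-- Unfolding of `dbarAlongₛₗ`. [folklore] -/
@[simp]
theorem dbarAlongₛₗ_apply (u : E → F) (x v : E) : dbarAlongₛₗ F u x v = dbarAlong v u x := rfl

/-- If `∂̄_v u (x) = 0` for `v` in a spanning set, then for all `v`. [folklore] -/
theorem dbarAlong_eq_zero_of_span_eq_top {u : E → F} {x : E} {s : Set E}
    (hs : Submodule.span ℂ s = ⊤) (h : ∀ v ∈ s, dbarAlong v u x = 0) (v : E) :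
    dbarAlong v u x = 0 := by
  have hle : Submodule.span ℂ s ≤ LinearMap.ker (dbarAlongₛₗ F u x) :=
    Submodule.span_le.2 fun w hw => by simpa using h w hw
  have hv : v ∈ LinearMap.ker (dbarAlongₛₗ F u x) := hle (hs ▸ Submodule.mem_top)
  simpa using hv

/-- On `ℂ^ι`, the Cauchy–Riemann equations `∂u/∂z̄_j = 0` in the coordinate directions give
`∂̄_v u = 0` in every direction. [folklore] -/
theorem dbarAlong_eq_zero_of_forall_single {ι : Type*} [Fintype ι] [DecidableEq ι]
    {u : (ι → ℂ) → F} {x : ι → ℂ} (h : ∀ j, dbarAlong (Pi.single j 1) u x = 0) (v : ι → ℂ) :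
    dbarAlong v u x = 0 := by
  refine dbarAlong_eq_zero_of_span_eq_top (s := Set.range fun j : ι => Pi.single j (1 : ℂ))
    ?_ (by rintro _ ⟨j, rfl⟩; exact h j) v
  have h1 : (fun j : ι => Pi.single j (1 : ℂ)) = ⇑(Pi.basisFun ℂ ι) := by
    ext j
    simp [Pi.basisFun_apply]
  rw [h1]
  exact (Pi.basisFun ℂ ι).span_eq

/-! ### The Cauchy–Riemann equations -/

/-- A real-linear map `A` with `A (i v) = i A v` is complex-linear. [folklore] -/
def _root_.ContinuousLinearMap.complexOfCommuteI (A : E →L[ℝ] F)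
    (hA : ∀ v, A (I • v) = I • A v) : E →L[ℂ] F where
  toFun := A
  map_add' := A.map_add
  map_smul' c v := by
    have hc : c • v = (c.re : ℝ) • v + (c.im : ℝ) • (I • v) := by
      rw [← coe_smul, ← coe_smul, smul_smul, ← add_smul, re_add_im]
    rw [hc, A.map_add, A.map_smul, A.map_smul, hA, ← coe_smul, ← coe_smul, smul_smul, ← add_smul,
      re_add_im]
    rfl
  cont := A.continuous

/-- Unfolding of `ContinuousLinearMap.complexOfCommuteI`. [folklore] -/
@[simp]
theorem _root_.ContinuousLinearMap.complexOfCommuteI_apply (A : E →L[ℝ] F)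
    (hA : ∀ v, A (I • v) = I • A v) (v : E) : A.complexOfCommuteI hA v = A v := rfl

/-- **Holomorphy iff the Cauchy–Riemann equations hold in every direction**: for `u`
real-differentiable at `x`, `u` is complex-differentiable at `x` iff `∂̄_v u (x) = 0` for all
`v` (Hörmander (1973), §1.1/§2.1). [cite: HormanderSCV1973, §2.1] -/
theorem differentiableAt_complex_iff_dbarAlong_eq_zero {u : E → F} {x : E}
    (hu : DifferentiableAt ℝ u x) :
    DifferentiableAt ℂ u x ↔ ∀ v, dbarAlong v u x = 0 := by
  refine ⟨fun h v => dbarAlong_eq_zero_of_differentiableAt h v, fun h => ?_⟩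
  have hA : ∀ v, fderiv ℝ u x (I • v) = I • fderiv ℝ u x v := fun v => by
    have h1 := h v
    rw [dbarAlong_apply, smul_eq_zero, or_iff_right (inv_ne_zero two_ne_zero)] at h1
    rw [eq_neg_of_add_eq_zero_left h1, smul_neg, smul_smul, I_mul_I, neg_one_smul, neg_neg]
  exact (differentiableAt_iff_restrictScalars ℝ hu).2
    ⟨(fderiv ℝ u x).complexOfCommuteI hA, by ext v; rfl⟩

/-- **The Cauchy–Riemann equations on `ℂ^ι`** (Hörmander (1973), Def. 2.1.1 and (2.1.2)): a
function real-differentiable at `x` with `∂u/∂z̄_j (x) = 0` for all coordinates `j` is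
complex-differentiable at `x`. [cite: HormanderSCV1973, Def. 2.1.1] -/
theorem differentiableAt_complex_of_forall_single {ι : Type*} [Fintype ι] [DecidableEq ι]
    {u : (ι → ℂ) → F} {x : ι → ℂ} (hu : DifferentiableAt ℝ u x)
    (h : ∀ j, dbarAlong (Pi.single j 1) u x = 0) : DifferentiableAt ℂ u x :=
  (differentiableAt_complex_iff_dbarAlong_eq_zero hu).2 (dbarAlong_eq_zero_of_forall_single h)

/-- A `C¹` function on an open set of `ℂ^ι` satisfying the Cauchy–Riemann equations there is
holomorphic there. [cite: HormanderSCV1973, Def. 2.1.1] -/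
theorem differentiableOn_complex_of_forall_single {ι : Type*} [Fintype ι] [DecidableEq ι]
    {u : (ι → ℂ) → F} {U : Set (ι → ℂ)} (hU : IsOpen U) (hu : DifferentiableOn ℝ u U)
    (h : ∀ x ∈ U, ∀ j, dbarAlong (Pi.single j 1) u x = 0) : DifferentiableOn ℂ u U :=
  fun x hx => (differentiableAt_complex_of_forall_single
    (hu.differentiableAt (hU.mem_nhds hx)) (h x hx)).differentiableWithinAt

end Literature.Analysis.Complex
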